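import Summits.KontsevichZagierPeriods.Zeta5Search.Barrier.ConeGammaCuspSlopeConvexityOrbit

/-!
# ζ(5) search — BARRIER: THE CONVEXITY TYPE OF THE TRANSLATE INTEGRAL inside the rate ball and at the closed orbit
# (file (4) of «CONVEXITY TYPE»)

HONEST FRAMING (cell `pub-zeta5`): systematic search; no irrationality claim unless kernel-certified. MODEL objects
under Brown–Zudilin's (28)+(30) accounting ([BZ22] = arXiv:2210.03391; (28) observed, not proved); nothing here is a
statement about `ζ(5)`, any `γ` of record, the cone's supremum (C2 OPEN) or the value / sign / convexity type of the translate
integral or of the cusp slope at a named direction (DATA of the cell); NO cancellation is quantified; S-E / S-E′ / (TD_A) stay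
CONJECTURED; records in print UNMOVED. Prover P2 g44 (item «CONVEXITY TYPE», file (4); plan INBOX 2026-08-28). Sources: files
(1)–(3) of this item, P2 g43 `ConeGammaTranslateTangentCone` (`translateIntegral_eq_add_lex_functional_eventually`,
`translateIntegral_eventuallyEq_cuspSlope_add`, `differentiableAt_translateIntegral_iff_cuspSlope`) and
`ConeGammaTranslateTangentConeOrbit` (`exists_rateBall_radius`, `isLocalMax_translateIntegral_zero_iff`).

SETTING as in file (1); `P = translateIntegral a T`, `P(δ) = ∫₀ᵀ 𝒩(u·s(a) + δ) du`; the OPEN RATE BALL `|r_k(δ)| < ρ̄` with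
`2ρ̄·T·x_max² < 1`, `2ρ̄·x_max < min(1, wallDist a T)` (P2 g42/g43), inside which `P = σ + const` near every point and the tangent
cone of `P` is attained on a neighbourhood with the SAME chamber functionals as `σ`. Hence, by the abstract criterion of file (1):
* **`convexOn_translateIntegral_nhds_iff`** — at a translate `δ` of the open ball, `P` is convex on some neighbourhood of `δ` iff
  for every `Δ`, every generic `δ₀` refining the lexicographic order of `(δ, Δ)` and every generic `δ₀'` refining `δ`,
  `Σ_k W_k(δ₀')·r_k(Δ) ≤ Σ_k W_k(δ₀)·r_k(Δ)`; **`convexOn_translateIntegral_nhds_iff_cuspSlope`** — iff `σ` is convex near `δ`; the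
  concave twins; **`differentiableAt_translateIntegral_iff_convexOn_and_concaveOn`**;
* **`translateIntegral_eventually_const_of_convexOn_of_isLocalMax`** — a translate of the open ball at which `P` is locally convex
  and locally maximal is a point near which `P` is CONSTANT (file (2) for `σ`, transferred); the concave / minimum twin;
* THE CLOSED ORBIT `δ = 0` (a translate of the open ball, P2 g43 (4)): **`convexOn_translateIntegral_nhds_zero_iff_subadditive`**
  — `P` is convex near the closed orbit iff `σ` is SUBADDITIVE (file (3)); `concaveOn_…_iff_superadditive`;
  **`translateIntegral_eventually_const_of_convexOn_nhds_zero_of_isLocalMax`** — if `P` is convex near `0` and the closed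
  orbit is a local maximiser of `P` (⟺ `σ ≤ 0` everywhere, P2 g43), then `σ ≡ 0` AND `P` is constant near `0`: a local maximum
  of the MODEL translate integral at the closed orbit is either FLAT or a kink of non-convex type.
NOT here (honest): the convexity type of `P` or `σ` at any named direction (DATA); anything beyond the rate ball ((TD_A)
CONJECTURED); `Φ`, `γ` of record, C2, S-E, `ζ(5)`.
-/

noncomputable section

open Set Finset Filter
open scoped Topology

namespace Summit.KontsevichZagierPeriods.Zeta5Search.Barrier.ConeGamma

/-! ### The criterion for `P` inside the open rate ball -/

/-- **THE CONVEXITY CRITERION FOR `P` AT A TRANSLATE OF THE OPEN BALL.** All 28 forms of `a` positive, `T > 0` a period, `F` the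
canonical period pattern function, `δ` in the open rate ball. Then `P` is convex on some neighbourhood of `δ` iff for every `Δ`,
every generic `δ₀` refining the lexicographic order of `(δ, Δ)` and every generic `δ₀'` refining `δ`:
`Σ_k W_k(δ₀')·φ_k(Δ)/h_k(a) ≤ Σ_k W_k(δ₀)·φ_k(Δ)/h_k(a)`. -/
theorem convexOn_translateIntegral_nhds_iff {a : Dir} (hpos : ∀ k, 0 < h28 a k) {T : ℝ} (hT : 0 < T)
    (hper : ∀ k : Fin 28, ∃ z : ℤ, T * h28 a k = z) {F : Finset (Fin 28) → ℝ}
    (hF : ∀ A, F A = ∑ m ∈ Finset.range ((bkpts a T).card - 1), ((patternN a (bkpt a T m) A : ℤ) : ℝ))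
    {δ : Fin 8 → ℝ} {ρb : ℝ} (hρ : ∀ k, |phiForm δ k / h28 a k| < ρb) (hρT : 2 * ρb * T * xMax a ^ 2 < 1)
    (hc1 : 2 * ρb * xMax a < 1) (hc2 : 2 * ρb * xMax a < wallDist a T) :
    (∃ U ∈ 𝓝 δ, ConvexOn ℝ U (translateIntegral a T)) ↔
      ∀ Δ δ₀ δ₀' : Fin 8 → ℝ, (∀ k l : Fin 28, k ≠ l → phiForm δ₀ k / h28 a k ≠ phiForm δ₀ l / h28 a l) →
        (∀ k l : Fin 28, k ≠ l → phiForm δ₀' k / h28 a k ≠ phiForm δ₀' l / h28 a l) →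
        (∀ k l : Fin 28, (phiForm δ k / h28 a k < phiForm δ l / h28 a l ∨
            (phiForm δ k / h28 a k = phiForm δ l / h28 a l ∧ phiForm Δ k / h28 a k < phiForm Δ l / h28 a l)) →
          phiForm δ₀ k / h28 a k < phiForm δ₀ l / h28 a l) →
        (∀ k l : Fin 28, phiForm δ k / h28 a k < phiForm δ l / h28 a l →
          phiForm δ₀' k / h28 a k < phiForm δ₀' l / h28 a l) →
        ∑ k, (F (Finset.univ.filter fun l => phiForm δ₀' k / h28 a k ≤ phiForm δ₀' l / h28 a l) -
            F (Finset.univ.filter fun l => phiForm δ₀' k / h28 a k < phiForm δ₀' l / h28 a l)) *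
          (phiForm Δ k / h28 a k) ≤
        ∑ k, (F (Finset.univ.filter fun l => phiForm δ₀ k / h28 a k ≤ phiForm δ₀ l / h28 a l) -
            F (Finset.univ.filter fun l => phiForm δ₀ k / h28 a k < phiForm δ₀ l / h28 a l)) *
          (phiForm Δ k / h28 a k) :=
  convexOn_nhds_iff_of_germ hpos
    (W := fun δ₁ k => F (Finset.univ.filter fun l => phiForm δ₁ k / h28 a k ≤ phiForm δ₁ l / h28 a l) -
      F (Finset.univ.filter fun l => phiForm δ₁ k / h28 a k < phiForm δ₁ l / h28 a l))
    (translateIntegral_eq_add_lex_functional_eventually hpos hT hper hF hρ hρT hc1 hc2)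

/-- **INSIDE THE OPEN BALL, `P` IS LOCALLY CONVEX AT `δ` IFF `σ` IS** (same criterion). -/
theorem convexOn_translateIntegral_nhds_iff_cuspSlope {a : Dir} (hpos : ∀ k, 0 < h28 a k) {T : ℝ} (hT : 0 < T)
    (hper : ∀ k : Fin 28, ∃ z : ℤ, T * h28 a k = z) {δ : Fin 8 → ℝ} {ρb : ℝ} (hρ : ∀ k, |phiForm δ k / h28 a k| < ρb)
    (hρT : 2 * ρb * T * xMax a ^ 2 < 1) (hc1 : 2 * ρb * xMax a < 1) (hc2 : 2 * ρb * xMax a < wallDist a T) :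
    (∃ U ∈ 𝓝 δ, ConvexOn ℝ U (translateIntegral a T)) ↔ ∃ U ∈ 𝓝 δ, ConvexOn ℝ U (cuspSlope a T) := by
  classical
  obtain ⟨F, hF⟩ : ∃ F : Finset (Fin 28) → ℝ,
      ∀ A, F A = ∑ m ∈ Finset.range ((bkpts a T).card - 1), ((patternN a (bkpt a T m) A : ℤ) : ℝ) := ⟨_, fun _ => rfl⟩
  rw [convexOn_translateIntegral_nhds_iff hpos hT hper hF hρ hρT hc1 hc2, convexOn_cuspSlope_nhds_iff hpos hT hper hF δ]

/-- **THE CONCAVITY CRITERION FOR `P` AT A TRANSLATE OF THE OPEN BALL** (the reversed domination). -/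
theorem concaveOn_translateIntegral_nhds_iff {a : Dir} (hpos : ∀ k, 0 < h28 a k) {T : ℝ} (hT : 0 < T)
    (hper : ∀ k : Fin 28, ∃ z : ℤ, T * h28 a k = z) {F : Finset (Fin 28) → ℝ}
    (hF : ∀ A, F A = ∑ m ∈ Finset.range ((bkpts a T).card - 1), ((patternN a (bkpt a T m) A : ℤ) : ℝ))
    {δ : Fin 8 → ℝ} {ρb : ℝ} (hρ : ∀ k, |phiForm δ k / h28 a k| < ρb) (hρT : 2 * ρb * T * xMax a ^ 2 < 1)
    (hc1 : 2 * ρb * xMax a < 1) (hc2 : 2 * ρb * xMax a < wallDist a T) :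
    (∃ U ∈ 𝓝 δ, ConcaveOn ℝ U (translateIntegral a T)) ↔
      ∀ Δ δ₀ δ₀' : Fin 8 → ℝ, (∀ k l : Fin 28, k ≠ l → phiForm δ₀ k / h28 a k ≠ phiForm δ₀ l / h28 a l) →
        (∀ k l : Fin 28, k ≠ l → phiForm δ₀' k / h28 a k ≠ phiForm δ₀' l / h28 a l) →
        (∀ k l : Fin 28, (phiForm δ k / h28 a k < phiForm δ l / h28 a l ∨
            (phiForm δ k / h28 a k = phiForm δ l / h28 a l ∧ phiForm Δ k / h28 a k < phiForm Δ l / h28 a l)) →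
          phiForm δ₀ k / h28 a k < phiForm δ₀ l / h28 a l) →
        (∀ k l : Fin 28, phiForm δ k / h28 a k < phiForm δ l / h28 a l →
          phiForm δ₀' k / h28 a k < phiForm δ₀' l / h28 a l) →
        ∑ k, (F (Finset.univ.filter fun l => phiForm δ₀ k / h28 a k ≤ phiForm δ₀ l / h28 a l) -
            F (Finset.univ.filter fun l => phiForm δ₀ k / h28 a k < phiForm δ₀ l / h28 a l)) *
          (phiForm Δ k / h28 a k) ≤
        ∑ k, (F (Finset.univ.filter fun l => phiForm δ₀' k / h28 a k ≤ phiForm δ₀' l / h28 a l) -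
            F (Finset.univ.filter fun l => phiForm δ₀' k / h28 a k < phiForm δ₀' l / h28 a l)) *
          (phiForm Δ k / h28 a k) :=
  concaveOn_nhds_iff_of_germ hpos
    (W := fun δ₁ k => F (Finset.univ.filter fun l => phiForm δ₁ k / h28 a k ≤ phiForm δ₁ l / h28 a l) -
      F (Finset.univ.filter fun l => phiForm δ₁ k / h28 a k < phiForm δ₁ l / h28 a l))
    (translateIntegral_eq_add_lex_functional_eventually hpos hT hper hF hρ hρT hc1 hc2)

/-- **INSIDE THE OPEN BALL, `P` IS LOCALLY CONCAVE AT `δ` IFF `σ` IS.** -/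
theorem concaveOn_translateIntegral_nhds_iff_cuspSlope {a : Dir} (hpos : ∀ k, 0 < h28 a k) {T : ℝ} (hT : 0 < T)
    (hper : ∀ k : Fin 28, ∃ z : ℤ, T * h28 a k = z) {δ : Fin 8 → ℝ} {ρb : ℝ} (hρ : ∀ k, |phiForm δ k / h28 a k| < ρb)
    (hρT : 2 * ρb * T * xMax a ^ 2 < 1) (hc1 : 2 * ρb * xMax a < 1) (hc2 : 2 * ρb * xMax a < wallDist a T) :
    (∃ U ∈ 𝓝 δ, ConcaveOn ℝ U (translateIntegral a T)) ↔ ∃ U ∈ 𝓝 δ, ConcaveOn ℝ U (cuspSlope a T) := by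
  classical
  obtain ⟨F, hF⟩ : ∃ F : Finset (Fin 28) → ℝ,
      ∀ A, F A = ∑ m ∈ Finset.range ((bkpts a T).card - 1), ((patternN a (bkpt a T m) A : ℤ) : ℝ) := ⟨_, fun _ => rfl⟩
  rw [concaveOn_translateIntegral_nhds_iff hpos hT hper hF hρ hρT hc1 hc2, concaveOn_cuspSlope_nhds_iff hpos hT hper hF δ]

/-- **INSIDE THE OPEN BALL, `P` IS DIFFERENTIABLE AT `δ` IFF IT IS CONVEX NEAR `δ` AND CONCAVE NEAR `δ`.** -/
theorem differentiableAt_translateIntegral_iff_convexOn_and_concaveOn {a : Dir} (hpos : ∀ k, 0 < h28 a k) {T : ℝ}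
    (hT : 0 < T) (hper : ∀ k : Fin 28, ∃ z : ℤ, T * h28 a k = z) {δ : Fin 8 → ℝ} {ρb : ℝ}
    (hρ : ∀ k, |phiForm δ k / h28 a k| < ρb) (hρT : 2 * ρb * T * xMax a ^ 2 < 1) (hc1 : 2 * ρb * xMax a < 1)
    (hc2 : 2 * ρb * xMax a < wallDist a T) :
    DifferentiableAt ℝ (translateIntegral a T) δ ↔
      (∃ U ∈ 𝓝 δ, ConvexOn ℝ U (translateIntegral a T)) ∧ ∃ U ∈ 𝓝 δ, ConcaveOn ℝ U (translateIntegral a T) := by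
  rw [differentiableAt_translateIntegral_iff_cuspSlope hpos hT hper hρ hρT hc1 hc2,
    convexOn_translateIntegral_nhds_iff_cuspSlope hpos hT hper hρ hρT hc1 hc2,
    concaveOn_translateIntegral_nhds_iff_cuspSlope hpos hT hper hρ hρT hc1 hc2,
    differentiableAt_cuspSlope_iff_convexOn_and_concaveOn hpos hT hper δ]

/-! ### A locally convex `P` with a local maximum inside the ball is flat -/

/-- Inside the open ball, `δ` is a local maximiser of `P` iff it is one of `σ` (`P = σ + const` nearby). -/
theorem isLocalMax_translateIntegral_iff_cuspSlope {a : Dir} (hpos : ∀ k, 0 < h28 a k) {T : ℝ} (hT : 0 < T)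
    (hper : ∀ k : Fin 28, ∃ z : ℤ, T * h28 a k = z) {δ : Fin 8 → ℝ} {ρb : ℝ} (hρ : ∀ k, |phiForm δ k / h28 a k| < ρb)
    (hρT : 2 * ρb * T * xMax a ^ 2 < 1) (hc1 : 2 * ρb * xMax a < 1) (hc2 : 2 * ρb * xMax a < wallDist a T) :
    IsLocalMax (translateIntegral a T) δ ↔ IsLocalMax (cuspSlope a T) δ := by
  rw [(translateIntegral_eventuallyEq_cuspSlope_add hpos hT hper hρ hρT hc1 hc2).isLocalMax_iff]
  show (∀ᶠ x in 𝓝 δ, cuspSlope a T x + (translateIntegral a T δ - cuspSlope a T δ) ≤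
      cuspSlope a T δ + (translateIntegral a T δ - cuspSlope a T δ)) ↔
    ∀ᶠ x in 𝓝 δ, cuspSlope a T x ≤ cuspSlope a T δ
  simp only [add_le_add_iff_right]

/-- Inside the open ball, `δ` is a local minimiser of `P` iff it is one of `σ`. -/
theorem isLocalMin_translateIntegral_iff_cuspSlope {a : Dir} (hpos : ∀ k, 0 < h28 a k) {T : ℝ} (hT : 0 < T)
    (hper : ∀ k : Fin 28, ∃ z : ℤ, T * h28 a k = z) {δ : Fin 8 → ℝ} {ρb : ℝ} (hρ : ∀ k, |phiForm δ k / h28 a k| < ρb)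
    (hρT : 2 * ρb * T * xMax a ^ 2 < 1) (hc1 : 2 * ρb * xMax a < 1) (hc2 : 2 * ρb * xMax a < wallDist a T) :
    IsLocalMin (translateIntegral a T) δ ↔ IsLocalMin (cuspSlope a T) δ := by
  rw [(translateIntegral_eventuallyEq_cuspSlope_add hpos hT hper hρ hρT hc1 hc2).isLocalMin_iff]
  show (∀ᶠ x in 𝓝 δ, cuspSlope a T δ + (translateIntegral a T δ - cuspSlope a T δ) ≤
      cuspSlope a T x + (translateIntegral a T δ - cuspSlope a T δ)) ↔
    ∀ᶠ x in 𝓝 δ, cuspSlope a T δ ≤ cuspSlope a T x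
  simp only [add_le_add_iff_right]

/-- **A TRANSLATE OF THE OPEN BALL AT WHICH `P` IS LOCALLY CONVEX AND LOCALLY MAXIMAL IS A FLAT POINT**: `P(δ') = P(δ)` for all
`δ'` near `δ` (file (2)'s flatness of `σ`, transferred along `P = σ + const`). A kink of `P` of convex type inside the ball is
never a local maximum of `P`. -/
theorem translateIntegral_eventually_const_of_convexOn_of_isLocalMax {a : Dir} (hpos : ∀ k, 0 < h28 a k) {T : ℝ}
    (hT : 0 < T) (hper : ∀ k : Fin 28, ∃ z : ℤ, T * h28 a k = z) {δ : Fin 8 → ℝ} {ρb : ℝ}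
    (hρ : ∀ k, |phiForm δ k / h28 a k| < ρb) (hρT : 2 * ρb * T * xMax a ^ 2 < 1) (hc1 : 2 * ρb * xMax a < 1)
    (hc2 : 2 * ρb * xMax a < wallDist a T) (hconv : ∃ U ∈ 𝓝 δ, ConvexOn ℝ U (translateIntegral a T))
    (hmax : IsLocalMax (translateIntegral a T) δ) :
    ∀ᶠ δ' in 𝓝 δ, translateIntegral a T δ' = translateIntegral a T δ := by
  rw [convexOn_translateIntegral_nhds_iff_cuspSlope hpos hT hper hρ hρT hc1 hc2] at hconv
  rw [isLocalMax_translateIntegral_iff_cuspSlope hpos hT hper hρ hρT hc1 hc2] at hmax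
  filter_upwards [translateIntegral_eventuallyEq_cuspSlope_add hpos hT hper hρ hρT hc1 hc2,
    cuspSlope_eventually_const_of_convexOn_of_isLocalMax hpos hT hper hconv hmax] with δ' h1 h2
  rw [h1, h2]
  ring

/-- **A TRANSLATE OF THE OPEN BALL AT WHICH `P` IS LOCALLY CONCAVE AND LOCALLY MINIMAL IS A FLAT POINT** (twin). -/
theorem translateIntegral_eventually_const_of_concaveOn_of_isLocalMin {a : Dir} (hpos : ∀ k, 0 < h28 a k) {T : ℝ}
    (hT : 0 < T) (hper : ∀ k : Fin 28, ∃ z : ℤ, T * h28 a k = z) {δ : Fin 8 → ℝ} {ρb : ℝ}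
    (hρ : ∀ k, |phiForm δ k / h28 a k| < ρb) (hρT : 2 * ρb * T * xMax a ^ 2 < 1) (hc1 : 2 * ρb * xMax a < 1)
    (hc2 : 2 * ρb * xMax a < wallDist a T) (hconc : ∃ U ∈ 𝓝 δ, ConcaveOn ℝ U (translateIntegral a T))
    (hmin : IsLocalMin (translateIntegral a T) δ) :
    ∀ᶠ δ' in 𝓝 δ, translateIntegral a T δ' = translateIntegral a T δ := by
  rw [concaveOn_translateIntegral_nhds_iff_cuspSlope hpos hT hper hρ hρT hc1 hc2] at hconc
  rw [isLocalMin_translateIntegral_iff_cuspSlope hpos hT hper hρ hρT hc1 hc2] at hmin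
  filter_upwards [translateIntegral_eventuallyEq_cuspSlope_add hpos hT hper hρ hρT hc1 hc2,
    cuspSlope_eventually_const_of_concaveOn_of_isLocalMin hpos hT hper hconc hmin] with δ' h1 h2
  rw [h1, h2]
  ring

/-! ### The closed orbit -/

/-- **`P` IS CONVEX NEAR THE CLOSED ORBIT IFF THE CUSP SLOPE IS SUBADDITIVE.** All 28 forms of `a` positive, `T > 0` a period:
`(∃ U ∈ 𝓝 0, ConvexOn ℝ U P) ↔ ∀ Δ Δ', σ(Δ + Δ') ≤ σ(Δ) + σ(Δ')` (a rate-ball radius exists, P2 g43; file (3)). -/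
theorem convexOn_translateIntegral_nhds_zero_iff_subadditive {a : Dir} (hpos : ∀ k, 0 < h28 a k) {T : ℝ} (hT : 0 < T)
    (hper : ∀ k : Fin 28, ∃ z : ℤ, T * h28 a k = z) :
    (∃ U ∈ 𝓝 (0 : Fin 8 → ℝ), ConvexOn ℝ U (translateIntegral a T)) ↔
      ∀ Δ Δ' : Fin 8 → ℝ, cuspSlope a T (Δ + Δ') ≤ cuspSlope a T Δ + cuspSlope a T Δ' := by
  obtain ⟨ρb, hρb, hρT, hc1, hc2⟩ := exists_rateBall_radius hpos hT
  rw [convexOn_translateIntegral_nhds_iff_cuspSlope hpos hT hper (fun k => rates_zero_lt hρb k) hρT hc1 hc2,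
    convexOn_cuspSlope_nhds_zero_iff_univ hpos hT hper, convexOn_univ_cuspSlope_iff_subadditive hpos hT hper]

/-- **`P` IS CONCAVE NEAR THE CLOSED ORBIT IFF THE CUSP SLOPE IS SUPERADDITIVE.** -/
theorem concaveOn_translateIntegral_nhds_zero_iff_superadditive {a : Dir} (hpos : ∀ k, 0 < h28 a k) {T : ℝ} (hT : 0 < T)
    (hper : ∀ k : Fin 28, ∃ z : ℤ, T * h28 a k = z) :
    (∃ U ∈ 𝓝 (0 : Fin 8 → ℝ), ConcaveOn ℝ U (translateIntegral a T)) ↔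
      ∀ Δ Δ' : Fin 8 → ℝ, cuspSlope a T Δ + cuspSlope a T Δ' ≤ cuspSlope a T (Δ + Δ') := by
  obtain ⟨ρb, hρb, hρT, hc1, hc2⟩ := exists_rateBall_radius hpos hT
  rw [concaveOn_translateIntegral_nhds_iff_cuspSlope hpos hT hper (fun k => rates_zero_lt hρb k) hρT hc1 hc2,
    concaveOn_cuspSlope_nhds_zero_iff_univ hpos hT hper, concaveOn_univ_cuspSlope_iff_superadditive hpos hT hper]

/-- **A LOCAL MAXIMUM OF `P` AT THE CLOSED ORBIT IS FLAT OR OF NON-CONVEX TYPE.** All 28 forms of `a` positive, `T > 0` a period.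
If `P` is convex on some neighbourhood of `0` and `0` is a local maximiser of `P`, then the cusp slope vanishes identically AND
`P(δ) = P(0)` for all `δ` near `0` (P2 g43: `IsLocalMax P 0 ↔ σ ≤ 0` everywhere; file (3): subadditive and `≤ 0` forces `σ ≡ 0`).
Whether either hypothesis holds at a named lattice direction is DATA; no instance is asserted. -/
theorem translateIntegral_eventually_const_of_convexOn_nhds_zero_of_isLocalMax {a : Dir} (hpos : ∀ k, 0 < h28 a k)
    {T : ℝ} (hT : 0 < T) (hper : ∀ k : Fin 28, ∃ z : ℤ, T * h28 a k = z)
    (hconv : ∃ U ∈ 𝓝 (0 : Fin 8 → ℝ), ConvexOn ℝ U (translateIntegral a T))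
    (hmax : IsLocalMax (translateIntegral a T) 0) :
    (∀ Δ : Fin 8 → ℝ, cuspSlope a T Δ = 0) ∧
      ∀ᶠ δ in 𝓝 (0 : Fin 8 → ℝ), translateIntegral a T δ = translateIntegral a T 0 := by
  have hσ : ∀ Δ : Fin 8 → ℝ, cuspSlope a T Δ = 0 :=
    cuspSlope_eq_zero_of_subadditive_of_forall_nonpos
      ((convexOn_translateIntegral_nhds_zero_iff_subadditive hpos hT hper).mp hconv)
      ((isLocalMax_translateIntegral_zero_iff hpos hT hper).mp hmax)
  obtain ⟨ρb, hρb, hρT, hc1, hc2⟩ := exists_rateBall_radius hpos hT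
  refine ⟨hσ, ?_⟩
  filter_upwards [translateIntegral_eventuallyEq_cuspSlope_add hpos hT hper (fun k => rates_zero_lt hρb k) hρT hc1 hc2]
    with δ h
  rw [h, hσ δ, hσ 0, zero_add, sub_zero]

/-- **A LOCAL MINIMUM OF `P` AT THE CLOSED ORBIT IS FLAT OR OF NON-CONCAVE TYPE** (twin). -/
theorem translateIntegral_eventually_const_of_concaveOn_nhds_zero_of_isLocalMin {a : Dir} (hpos : ∀ k, 0 < h28 a k)
    {T : ℝ} (hT : 0 < T) (hper : ∀ k : Fin 28, ∃ z : ℤ, T * h28 a k = z)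
    (hconc : ∃ U ∈ 𝓝 (0 : Fin 8 → ℝ), ConcaveOn ℝ U (translateIntegral a T))
    (hmin : IsLocalMin (translateIntegral a T) 0) :
    (∀ Δ : Fin 8 → ℝ, cuspSlope a T Δ = 0) ∧
      ∀ᶠ δ in 𝓝 (0 : Fin 8 → ℝ), translateIntegral a T δ = translateIntegral a T 0 := by
  have hσ : ∀ Δ : Fin 8 → ℝ, cuspSlope a T Δ = 0 :=
    cuspSlope_eq_zero_of_superadditive_of_forall_nonneg
      ((concaveOn_translateIntegral_nhds_zero_iff_superadditive hpos hT hper).mp hconc)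
      ((isLocalMin_translateIntegral_zero_iff hpos hT hper).mp hmin)
  obtain ⟨ρb, hρb, hρT, hc1, hc2⟩ := exists_rateBall_radius hpos hT
  refine ⟨hσ, ?_⟩
  filter_upwards [translateIntegral_eventuallyEq_cuspSlope_add hpos hT hper (fun k => rates_zero_lt hρb k) hρT hc1 hc2]
    with δ h
  rw [h, hσ δ, hσ 0, zero_add, sub_zero]

end Summit.KontsevichZagierPeriods.Zeta5Search.Barrier.ConeGamma

end
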